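import Literature.NumberTheory.DiophantineGeometry.GenEllConjugateCompactness
import HarnessLib

/-!
# [GenEll] Thm. 2.1, proof, Step "(ii) ⟹ (i)": compactness of conjugate configurations in bounded
# degree at SEVERAL primes (the place-indexed finite-subcover theorem)

S. Mochizuki, *Arithmetic elliptic curves in general position*, Math. J. Okayama Univ. 52 (2010),
proof of Theorem 2.1, p. 12: "by the compactness of the set of rational points … over any finite
extension of `ℚ_v` **for `v ∈ V`**" — the compactness step runs over a FINITE SET of places `V`.
[cite: MochizukiGenEll2010, Thm 2.1 proof p.12]

This file is the place-indexed form of `GenEllConjugateCompactness` (abc-iut-w5-d081, ONE prime):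
the nonarchimedean places are a finite index type `Λ` of primes `pr : Λ → ℕ` (in the `GenEllTwo`
assembly: `{2} ∪ S_bad(e, B)`, the interface contract R-a′ of the W5 coordinator abc-iut-w5-d045 and
owner RULING 01:09Z, cell abc-iut), a configuration is a `d`-tuple of points of `ℂ ∪ {∞}` together with
a `d`-tuple of points of `Q̄_p ∪ {∞}` FOR EVERY `p = pr l`, and a mechanism applies to a point `P`
when all complex conjugates of `P.x` lie in `Uarc i` and, for every `l`, all `Q̄_{pr l}`-conjugates lie
in `Unon i l`.

* `exists_finset_cover_of_degree_le_places` — finite subcover: the configuration space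
  `(ℙ¹(ℂ))^d × ∏_l (ℙ¹(L_{d,l}))^d` is compact (ONE finite extension `L_{d,l}/ℚ_{pr l}` per place,
  d081's `exists_intermediateField_forall_conj_mem` factor by factor);
* `vojtaIneq_univ_of_cover_places` — Vojta in degree `≤ d` from a covering family of mechanisms;
* `cover_of_monotone_of_exact_places`, `vojtaIneq_univ_of_monotone_cover_places` — the covering
  hypothesis for a monotone family `(k, n)` from exact (`r = 0`) avoidance, as in the one-prime file.

Proofs are d081's, one `∀ l` deeper. Theorems only; classical; nothing here bears on anything
disputed.
-/

noncomputable section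

open NumberField Set OnePoint

namespace Literature.NumberTheory.DiophantineGeometry.GenEll

/-- **Finite subcover, several primes.** Places: `∞` and the primes `pr l`, `l : Λ` (finite). A
mechanism `i : ι` is a family of OPEN sets `Uarc i ⊆ ℂ`, `Unon i l ⊆ Q̄_{pr l}`, possibly declared open
at `∞` (`i ∈ Iarc`, `i ∈ Inon l`; then containing some `{‖z‖ > R}`). If every configuration —
`a : Fin d → ℂ ∪ {∞}` and, for every `l`, `b l : Fin d → Q̄_{pr l} ∪ {∞}` — lies in one mechanism
(entries `∞` admissible exactly where the mechanism is open at `∞`), then FINITELY MANY mechanisms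
apply to all points of degree `≤ d`. [cite: MochizukiGenEll2010, Thm 2.1 proof p.12] -/
theorem exists_finset_cover_of_degree_le_places {Λ : Type*} [Finite Λ] (pr : Λ → ℕ)
    [hpr : ∀ l, Fact (pr l).Prime] (d : ℕ) {ι : Type*}
    (Uarc : ι → Set ℂ) (hUarc : ∀ i, IsOpen (Uarc i))
    (Unon : ι → (l : Λ) → Set (PadicAlgCl (pr l))) (hUnon : ∀ i l, IsOpen (Unon i l))
    (Iarc : Set ι) (Inon : Λ → Set ι)
    (hIarc : ∀ i ∈ Iarc, ∃ R : ℝ, ∀ z : ℂ, R < ‖z‖ → z ∈ Uarc i)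
    (hInon : ∀ l, ∀ i ∈ Inon l, ∃ R : ℝ, ∀ z : PadicAlgCl (pr l), R < ‖z‖ → z ∈ Unon i l)
    (hcover : ∀ (a : Fin d → OnePoint ℂ) (b : (l : Λ) → Fin d → OnePoint (PadicAlgCl (pr l))),
      ∃ i : ι, (∀ j, (∃ z ∈ Uarc i, a j = ↑z) ∨ (a j = ∞ ∧ i ∈ Iarc)) ∧
        (∀ l j, (∃ z ∈ Unon i l, b l j = ↑z) ∨ (b l j = ∞ ∧ i ∈ Inon l))) :
    ∃ s : Finset ι, ∀ P : NFPoint, P.degree ≤ d → ∃ i ∈ s,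
      (∀ σ : P.F →+* ℂ, σ P.x ∈ Uarc i) ∧
        (∀ l, ∀ σ : P.F →+* PadicAlgCl (pr l), σ P.x ∈ Unon i l) := by
  classical
  -- one finite extension `L l` of `ℚ_{pr l}` per place, containing all conjugates in degree `≤ d`
  have hex : ∀ l, ∃ L : IntermediateField ℚ_[pr l] (PadicAlgCl (pr l)),
      FiniteDimensional ℚ_[pr l] L ∧ ∀ (F : Type) [Field F] [NumberField F],
        Module.finrank ℚ F ≤ d → ∀ (σ : F →+* PadicAlgCl (pr l)) (x : F), σ x ∈ L :=
    fun l => exists_intermediateField_forall_conj_mem (pr l) d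
  choose L hLfd hL using hex
  haveI : ∀ l, FiniteDimensional ℚ_[pr l] (L l) := hLfd
  haveI : ∀ l, ProperSpace (L l) := fun l => FiniteDimensional.proper ℚ_[pr l] (L l)
  -- the open subsets of the one-point compactifications attached to a mechanism
  let A : ι → Set (OnePoint ℂ) := fun i =>
    {ω | (∃ z ∈ Uarc i, ω = ↑z) ∨ (ω = ∞ ∧ i ∈ Iarc)}
  let B : ι → (l : Λ) → Set (OnePoint (L l)) := fun i l =>
    {ω | (∃ y ∈ {y : L l | (y : PadicAlgCl (pr l)) ∈ Unon i l}, ω = ↑y) ∨ (ω = ∞ ∧ i ∈ Inon l)}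
  have hA : ∀ i, IsOpen (A i) := fun i =>
    isOpen_setOf_coe_mem_or_infty (hUarc i) (hIarc i)
  have hB : ∀ i l, IsOpen (B i l) := fun i l => by
    refine isOpen_setOf_coe_mem_or_infty ((hUnon i l).preimage continuous_subtype_val) ?_
    intro hi
    obtain ⟨R, hR⟩ := hInon l i hi
    exact ⟨R, fun y hy => hR (y : PadicAlgCl (pr l)) (by simpa using hy)⟩
  -- the open subsets of the compact configuration space
  let W : ι → Set ((Fin d → OnePoint ℂ) × ((l : Λ) → Fin d → OnePoint (L l))) := fun i =>
    {τ | (∀ j, τ.1 j ∈ A i) ∧ (∀ l j, τ.2 l j ∈ B i l)}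
  have hW : ∀ i, IsOpen (W i) := fun i => by
    have h1 : IsOpen {τ : (Fin d → OnePoint ℂ) × ((l : Λ) → Fin d → OnePoint (L l)) |
        ∀ j, τ.1 j ∈ A i} := by
      rw [show {τ : (Fin d → OnePoint ℂ) × ((l : Λ) → Fin d → OnePoint (L l)) | ∀ j, τ.1 j ∈ A i} =
        ⋂ j, (fun τ => τ.1 j) ⁻¹' (A i) from by ext τ; simp]
      exact isOpen_iInter_of_finite fun j =>
        (hA i).preimage ((continuous_apply j).comp continuous_fst)
    have h2 : IsOpen {τ : (Fin d → OnePoint ℂ) × ((l : Λ) → Fin d → OnePoint (L l)) |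
        ∀ l j, τ.2 l j ∈ B i l} := by
      rw [show {τ : (Fin d → OnePoint ℂ) × ((l : Λ) → Fin d → OnePoint (L l)) |
          ∀ l j, τ.2 l j ∈ B i l} = ⋂ l, ⋂ j, (fun τ => τ.2 l j) ⁻¹' (B i l) from by ext τ; simp]
      exact isOpen_iInter_of_finite fun l => isOpen_iInter_of_finite fun j =>
        (hB i l).preimage ((continuous_apply j).comp ((continuous_apply l).comp continuous_snd))
    exact h1.inter h2
  -- they cover, by the configuration hypothesis
  have hWcover : (univ : Set ((Fin d → OnePoint ℂ) × ((l : Λ) → Fin d → OnePoint (L l)))) ⊆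
      ⋃ i, W i := by
    intro τ _
    obtain ⟨i, ha, hb⟩ :=
      hcover τ.1 (fun l j => (τ.2 l j).map ((↑) : L l → PadicAlgCl (pr l)))
    refine mem_iUnion.mpr ⟨i, ha, fun l j => ?_⟩
    have hbj := hb l j
    induction hτ : τ.2 l j using OnePoint.rec with
    | infty =>
      rw [hτ] at hbj
      rcases hbj with ⟨z, _, hz⟩ | ⟨_, hi⟩
      · exact absurd hz.symm (coe_ne_infty z)
      · exact Or.inr ⟨rfl, hi⟩
    | coe y =>
      rw [hτ] at hbj
      rcases hbj with ⟨z, hz, hyz⟩ | ⟨h, _⟩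
      · refine Or.inl ⟨y, ?_, rfl⟩
        have : (y : PadicAlgCl (pr l)) = z := by
          simpa [OnePoint.map_some] using hyz
        show (y : PadicAlgCl (pr l)) ∈ Unon i l
        rw [this]; exact hz
      · exact absurd h (by simp [OnePoint.map_some])
  obtain ⟨s, hs⟩ := isCompact_univ.elim_finite_subcover W hW hWcover
  refine ⟨s, fun P hP => ?_⟩
  -- the configuration of conjugates of `P`
  haveI : ∀ l, IsAlgClosed (PadicAlgCl (pr l)) := fun l => AlgebraicClosure.isAlgClosed _
  have hcardC : Fintype.card (P.F →+* ℂ) ≤ Fintype.card (Fin d) := by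
    rw [Fintype.card_fin, NumberField.Embeddings.card]; exact hP
  have hcardP : ∀ l, Fintype.card (P.F →+* PadicAlgCl (pr l)) ≤ Fintype.card (Fin d) := by
    intro l
    rw [Fintype.card_fin, NumberField.Embeddings.card]; exact hP
  haveI : Nonempty (P.F →+* ℂ) := by
    rw [← Fintype.card_pos_iff, NumberField.Embeddings.card]; exact P.degree_pos
  haveI : ∀ l, Nonempty (P.F →+* PadicAlgCl (pr l)) := by
    intro l
    rw [← Fintype.card_pos_iff, NumberField.Embeddings.card]; exact P.degree_pos
  obtain ⟨eC⟩ := Function.Embedding.nonempty_of_card_le hcardC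
  have heP : ∀ l, Nonempty ((P.F →+* PadicAlgCl (pr l)) ↪ Fin d) := fun l =>
    Function.Embedding.nonempty_of_card_le (hcardP l)
  let eP : (l : Λ) → ((P.F →+* PadicAlgCl (pr l)) ↪ Fin d) := fun l => (heP l).some
  let gC : Fin d → (P.F →+* ℂ) := Function.invFun eC
  let gP : (l : Λ) → Fin d → (P.F →+* PadicAlgCl (pr l)) := fun l => Function.invFun (eP l)
  have hgC : ∀ σ, gC (eC σ) = σ := Function.leftInverse_invFun eC.injective
  have hgP : ∀ l σ, gP l (eP l σ) = σ := fun l => Function.leftInverse_invFun (eP l).injective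
  let τ : (Fin d → OnePoint ℂ) × ((l : Λ) → Fin d → OnePoint (L l)) :=
    (fun j => ((gC j P.x : ℂ) : OnePoint ℂ),
      fun l j => ((⟨gP l j P.x, hL l P.F hP (gP l j) P.x⟩ : L l) : OnePoint (L l)))
  obtain ⟨i, hi, hτ⟩ := mem_iUnion₂.mp (hs (mem_univ τ))
  refine ⟨i, hi, fun σ => ?_, fun l σ => ?_⟩
  · have h := hτ.1 (eC σ)
    rcases h with ⟨z, hz, hσz⟩ | ⟨h, _⟩
    · have h1 : (((gC (eC σ)) P.x : ℂ) : OnePoint ℂ) = ↑z := hσz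
      have h2 : (gC (eC σ)) P.x = z := OnePoint.coe_injective h1
      rw [hgC] at h2
      rw [h2]; exact hz
    · exact absurd h (coe_ne_infty _)
  · have h := hτ.2 l (eP l σ)
    rcases h with ⟨y, hy, hσy⟩ | ⟨h, _⟩
    · have h1 : (((⟨gP l (eP l σ) P.x, hL l P.F hP (gP l (eP l σ)) P.x⟩ : L l)) : OnePoint (L l)) =
          ↑y := hσy
      have h2 : (⟨gP l (eP l σ) P.x, hL l P.F hP (gP l (eP l σ)) P.x⟩ : L l) = y :=
        OnePoint.coe_injective h1
      have h' : (gP l (eP l σ)) P.x = (y : PadicAlgCl (pr l)) := by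
        rw [← h2]
      rw [hgP] at h'
      rw [h']; exact hy
    · exact absurd h (coe_ne_infty _)

/-- **Vojta in degree `≤ d` from a covering family of mechanisms, several primes.** With the data
and covering hypothesis of `exists_finset_cover_of_degree_le_places`: if for every mechanism `i` the
Vojta inequality `ht ≲ (1+ε)(log-diff + log-cond)` holds in degree `≤ d` on the points to which `i`
applies, it holds on all of `U_P(Q̄)^{≤d}` (`VojtaIneq Set.univ d ε`).
[cite: MochizukiGenEll2010, Thm 2.1 proof p.12] -/
theorem vojtaIneq_univ_of_cover_places {Λ : Type*} [Finite Λ] (pr : Λ → ℕ)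
    [hpr : ∀ l, Fact (pr l).Prime] (d : ℕ) {ε : ℝ} {ι : Type*}
    (Uarc : ι → Set ℂ) (hUarc : ∀ i, IsOpen (Uarc i))
    (Unon : ι → (l : Λ) → Set (PadicAlgCl (pr l))) (hUnon : ∀ i l, IsOpen (Unon i l))
    (Iarc : Set ι) (Inon : Λ → Set ι)
    (hIarc : ∀ i ∈ Iarc, ∃ R : ℝ, ∀ z : ℂ, R < ‖z‖ → z ∈ Uarc i)
    (hInon : ∀ l, ∀ i ∈ Inon l, ∃ R : ℝ, ∀ z : PadicAlgCl (pr l), R < ‖z‖ → z ∈ Unon i l)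
    (hcover : ∀ (a : Fin d → OnePoint ℂ) (b : (l : Λ) → Fin d → OnePoint (PadicAlgCl (pr l))),
      ∃ i : ι, (∀ j, (∃ z ∈ Uarc i, a j = ↑z) ∨ (a j = ∞ ∧ i ∈ Iarc)) ∧
        (∀ l j, (∃ z ∈ Unon i l, b l j = ↑z) ∨ (b l j = ∞ ∧ i ∈ Inon l)))
    (hV : ∀ i, VojtaIneq {P : NFPoint | (∀ σ : P.F →+* ℂ, σ P.x ∈ Uarc i) ∧
      (∀ l, ∀ σ : P.F →+* PadicAlgCl (pr l), σ P.x ∈ Unon i l)} d ε) :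
    VojtaIneq Set.univ d ε := by
  classical
  obtain ⟨s, hs⟩ := exists_finset_cover_of_degree_le_places pr d Uarc hUarc Unon hUnon Iarc Inon
    hIarc hInon hcover
  choose C hC using hV
  refine ⟨∑ i ∈ s, |C i|, fun P hP => ?_⟩
  obtain ⟨i, hi, happ⟩ := hs P hP.2.2
  calc P.ht - (1 + ε) * (P.logDiff + P.logCond) ≤ C i := hC i P ⟨happ, hP.2⟩
    _ ≤ |C i| := le_abs_self _
    _ ≤ ∑ i ∈ s, |C i| := Finset.single_le_sum (f := fun i => |C i|) (fun _ _ => abs_nonneg _) hi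

/-- **The covering hypothesis for a monotone family from exact avoidance, several primes.** For
mechanisms indexed by `κ × ℕ` with `Uarc k n`, `Unon k l n` increasing in `n` and the flags at `∞`
depending only on `k`: if every configuration lies, for a single `k`, entrywise in `⋃ n, Uarc k n`
(resp. `⋃ n, Unon k l n`) or at an admissible `∞`, then it lies in a single mechanism `(k, n)`.
[cite: MochizukiGenEll2010, Thm 2.1 proof p.12] -/
theorem cover_of_monotone_of_exact_places {Λ : Type*} [Fintype Λ] (pr : Λ → ℕ)
    [hpr : ∀ l, Fact (pr l).Prime] (d : ℕ) {κ : Type*}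
    (Uarc : κ → ℕ → Set ℂ) (Unon : κ → (l : Λ) → ℕ → Set (PadicAlgCl (pr l)))
    (Iarc : Set κ) (Inon : Λ → Set κ)
    (hmonoArc : ∀ k n, Uarc k n ⊆ Uarc k (n + 1))
    (hmonoNon : ∀ k l n, Unon k l n ⊆ Unon k l (n + 1))
    (hexact : ∀ (a : Fin d → OnePoint ℂ) (b : (l : Λ) → Fin d → OnePoint (PadicAlgCl (pr l))),
      ∃ k : κ, (∀ j, (∃ n, ∃ z ∈ Uarc k n, a j = ↑z) ∨ (a j = ∞ ∧ k ∈ Iarc)) ∧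
        (∀ l j, (∃ n, ∃ z ∈ Unon k l n, b l j = ↑z) ∨ (b l j = ∞ ∧ k ∈ Inon l)))
    (a : Fin d → OnePoint ℂ) (b : (l : Λ) → Fin d → OnePoint (PadicAlgCl (pr l))) :
    ∃ i : κ × ℕ,
      (∀ j, (∃ z ∈ Uarc i.1 i.2, a j = ↑z) ∨ (a j = ∞ ∧ i ∈ {i : κ × ℕ | i.1 ∈ Iarc})) ∧
        (∀ l j, (∃ z ∈ Unon i.1 l i.2, b l j = ↑z) ∨
          (b l j = ∞ ∧ i ∈ {i : κ × ℕ | i.1 ∈ Inon l})) := by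
  classical
  obtain ⟨k, ha, hb⟩ := hexact a b
  have hmonoArc' : ∀ n m, n ≤ m → Uarc k n ⊆ Uarc k m := by
    intro n m hnm
    induction hnm with
    | refl => exact subset_rfl
    | step _ ih => exact ih.trans (hmonoArc k _)
  have hmonoNon' : ∀ l n m, n ≤ m → Unon k l n ⊆ Unon k l m := by
    intro l n m hnm
    induction hnm with
    | refl => exact subset_rfl
    | step _ ih => exact ih.trans (hmonoNon k l _)
  have hna : ∀ j, ∃ n, (∃ z ∈ Uarc k n, a j = ↑z) ∨ (a j = ∞ ∧ k ∈ Iarc) := by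
    intro j
    rcases ha j with ⟨n, z, hz, hj⟩ | h
    · exact ⟨n, Or.inl ⟨z, hz, hj⟩⟩
    · exact ⟨0, Or.inr h⟩
  have hnb : ∀ l j, ∃ n, (∃ z ∈ Unon k l n, b l j = ↑z) ∨ (b l j = ∞ ∧ k ∈ Inon l) := by
    intro l j
    rcases hb l j with ⟨n, z, hz, hj⟩ | h
    · exact ⟨n, Or.inl ⟨z, hz, hj⟩⟩
    · exact ⟨0, Or.inr h⟩
  choose na hna' using hna
  choose nb hnb' using hnb
  let N : ℕ := (Finset.univ.sup na) ⊔ (Finset.univ.sup fun lj : Λ × Fin d => nb lj.1 lj.2)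
  have hNa : ∀ j, na j ≤ N := fun j =>
    (Finset.le_sup (f := na) (Finset.mem_univ j)).trans le_sup_left
  have hNb : ∀ l j, nb l j ≤ N := fun l j =>
    (Finset.le_sup (f := fun lj : Λ × Fin d => nb lj.1 lj.2) (Finset.mem_univ (l, j))).trans
      le_sup_right
  refine ⟨(k, N), fun j => ?_, fun l j => ?_⟩
  · rcases hna' j with ⟨z, hz, hj⟩ | ⟨hj, hk⟩
    · exact Or.inl ⟨z, hmonoArc' _ _ (hNa j) hz, hj⟩
    · exact Or.inr ⟨hj, hk⟩
  · rcases hnb' l j with ⟨z, hz, hj⟩ | ⟨hj, hk⟩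
    · exact Or.inl ⟨z, hmonoNon' l _ _ (hNb l j) hz, hj⟩
    · exact Or.inr ⟨hj, hk⟩

/-- **Vojta in degree `≤ d` from a monotone family of mechanisms and exact avoidance, several
primes** — the composite of `cover_of_monotone_of_exact_places` and `vojtaIneq_univ_of_cover_places`.
[cite: MochizukiGenEll2010, Thm 2.1 proof p.12] -/
theorem vojtaIneq_univ_of_monotone_cover_places {Λ : Type*} [Fintype Λ] (pr : Λ → ℕ)
    [hpr : ∀ l, Fact (pr l).Prime] (d : ℕ) {ε : ℝ} {κ : Type*}
    (Uarc : κ → ℕ → Set ℂ) (hUarc : ∀ k n, IsOpen (Uarc k n))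
    (Unon : κ → (l : Λ) → ℕ → Set (PadicAlgCl (pr l))) (hUnon : ∀ k l n, IsOpen (Unon k l n))
    (Iarc : Set κ) (Inon : Λ → Set κ)
    (hIarc : ∀ k ∈ Iarc, ∀ n, ∃ R : ℝ, ∀ z : ℂ, R < ‖z‖ → z ∈ Uarc k n)
    (hInon : ∀ l, ∀ k ∈ Inon l, ∀ n, ∃ R : ℝ, ∀ z : PadicAlgCl (pr l), R < ‖z‖ → z ∈ Unon k l n)
    (hmonoArc : ∀ k n, Uarc k n ⊆ Uarc k (n + 1))
    (hmonoNon : ∀ k l n, Unon k l n ⊆ Unon k l (n + 1))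
    (hexact : ∀ (a : Fin d → OnePoint ℂ) (b : (l : Λ) → Fin d → OnePoint (PadicAlgCl (pr l))),
      ∃ k : κ, (∀ j, (∃ n, ∃ z ∈ Uarc k n, a j = ↑z) ∨ (a j = ∞ ∧ k ∈ Iarc)) ∧
        (∀ l j, (∃ n, ∃ z ∈ Unon k l n, b l j = ↑z) ∨ (b l j = ∞ ∧ k ∈ Inon l)))
    (hV : ∀ k n, VojtaIneq {P : NFPoint | (∀ σ : P.F →+* ℂ, σ P.x ∈ Uarc k n) ∧
      (∀ l, ∀ σ : P.F →+* PadicAlgCl (pr l), σ P.x ∈ Unon k l n)} d ε) :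
    VojtaIneq Set.univ d ε :=
  vojtaIneq_univ_of_cover_places pr d (fun i : κ × ℕ => Uarc i.1 i.2) (fun i => hUarc i.1 i.2)
    (fun i l => Unon i.1 l i.2) (fun i l => hUnon i.1 l i.2) {i | i.1 ∈ Iarc}
    (fun l => {i | i.1 ∈ Inon l})
    (fun i hi => hIarc i.1 hi i.2) (fun l i hi => hInon l i.1 hi i.2)
    (cover_of_monotone_of_exact_places pr d Uarc Unon Iarc Inon hmonoArc hmonoNon hexact)
    (fun i => hV i.1 i.2)

end Literature.NumberTheory.DiophantineGeometry.GenEll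

end
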